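import Mathlib
import Literature.Analysis.Complex.CauchyTransform
import Literature.Analysis.Complex.CauchyPompeiu
import Literature.Analysis.Complex.CauchyTransformHolderExtension
import Literature.Analysis.Complex.CauchyTransformHolderHigher
import Literature.Analysis.Complex.DbarAlongHolomorphic
import Literature.Analysis.FunctionSpaces.ContDiffHolderSpace
import Literature.Analysis.FunctionSpaces.ContDiffHolderBilinear
import Literature.Analysis.FunctionSpaces.ContDiffHolderLocalization
import Literature.Analysis.FunctionSpaces.ContDiffHolderExp
import Literature.Analysis.FunctionSpaces.HolderAlgebra
import Literature.Geometry.Symplectic.JHolomorphicRegularityHolderAux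
import HarnessLib

/-!
# Bootstrap and Cauchy-transform representation for the linear inhomogeneous `∂̄`-equation

Let `S' : ℂ → End_ℝ(ℂ²)` and `f : ℂ → ℂ²` be smooth with compact support, and let `w : ℂ → ℂ²` be
a `C¹` solution of the linear inhomogeneous Cauchy–Riemann equation

  `∂̄ w = S' w + f`     (`∂̄ = dbarAlong 1 = ½ (∂ₓ + i ∂_y)`),

bounded with bounded derivative and tending to a constant `c` at infinity. Then
(`contDiff_of_dbar_eq_linear`)

* `w = c + T (S' w + f)`, where `T = cauchyTransformAlong 1` is the Cauchy transform
  (`Literature/Analysis/Complex/CauchyTransform.lean`), and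
* `w ∈ C^∞`.

The representation: the density `d = S' w + f` is `C¹` with compact support, so `T d ∈ C¹` with
`∂̄ (T d) = d` (Hörmander, Thm. 1.2.2, `dbarAlong_cauchyTransformAlong`) and `T d → 0` at infinity
(`tendsto_cauchyTransform_cocompact`); hence `h = w - T d` is a `C¹` map with `∂̄ h = 0`, i.e. an
entire map (`differentiableAt_complex_iff_dbarAlong_eq_zero`), tending to `c` at infinity, so
`h ≡ c` by Liouville's theorem (`Differentiable.apply_eq_of_tendsto_cocompact`).

The smoothness, by bootstrapping the representation through the Hölder scale `C^{k,r}_b`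
(`Literature/Analysis/FunctionSpaces`): `w ∈ C^{0,r}_b` (bounded with bounded derivative), and if
`w ∈ C^{k,r}_b` then `d = S' w + f ∈ C^{k,r}_b` (pairing with smooth compactly supported
coefficients), so `T d ∈ C^{k+1,r}_b` by the bundled Cauchy-transform estimate
`cauchyTransform_contDiffHolder_succ` (which takes the a priori `C^{1,r}` estimate
`CauchyTransformHolderApriori (ℂ × ℂ) r` as a hypothesis), whence `w = c + T d ∈ C^{k+1,r}_b`.
This is the classical regularity theory of generalized analytic vectors (Vekua 1962, Ch. III).

## References

* I. N. Vekua, *Generalized Analytic Functions* (1962), Ch. I §5–§6 and Ch. III.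
* L. Hörmander, *An Introduction to Complex Analysis in Several Variables*, 2nd ed. (1973),
  Thm. 1.2.2. [HormanderSCV1973]
-/

noncomputable section

open scoped ContDiff Topology NNReal
open Filter Set Metric Function

namespace Literature.Analysis.Complex

open Literature.Analysis.FunctionSpaces Literature.Geometry.Symplectic

/-! ### Two membership lemmas for the Hölder classes -/

-- adapted from `CoreA.memContDiffHolder_clm_apply_of_smooth` in
-- `Summits/SmoothPoincare4/SmoothPoincare4/Theorems/SullivanDualTameOrBrodyR4CoreAKernel.lean`
/-- A smooth compactly supported operator field applied to a member of `C^{m,r}_b` is a member of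
`C^{m,r}_b` (`r ≤ 1`): the field is itself a member
(`MemContDiffHolder.of_contDiff_of_hasCompactSupport`) and the pairing is
`MemContDiffHolder.bilinear`. [folklore] -/
theorem memContDiffHolder_clm_apply_of_contDiff {Y Z : Type} [NormedAddCommGroup Y]
    [NormedSpace ℝ Y] [NormedAddCommGroup Z] [NormedSpace ℝ Z] {r : ℝ≥0} (hr : r ≤ 1) {m : ℕ}
    {Φ : ℂ → (Y →L[ℝ] Z)} (hΦ : ContDiff ℝ ∞ Φ) (hΦs : HasCompactSupport Φ) {w : ℂ → Y}
    (hw : MemContDiffHolder m r w) : MemContDiffHolder m r (fun x => Φ x (w x)) :=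
  MemContDiffHolder.bilinear hr (ContinuousLinearMap.id ℝ (Y →L[ℝ] Z))
    (MemContDiffHolder.of_contDiff_of_hasCompactSupport hΦ hΦs hr) hw

/-- A differentiable map on `ℂ` which is bounded with bounded derivative is in `C^{0,r}_b` for
`0 < r ≤ 1` (bounded and Lipschitz, hence `r`-Hölder: `holder_of_norm_fderiv_le`). [folklore] -/
theorem memContDiffHolder_zero_of_norm_fderiv_le {Y : Type*} [NormedAddCommGroup Y]
    [NormedSpace ℝ Y] {r : ℝ≥0} (hr0 : 0 < r) (hr1 : r ≤ 1) {w : ℂ → Y}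
    (hw : Differentiable ℝ w) {C : ℝ} (hC : ∀ z, ‖w z‖ ≤ C ∧ ‖fderiv ℝ w z‖ ≤ C) :
    MemContDiffHolder 0 r w := by
  have hC0 : 0 ≤ C := (norm_nonneg _).trans (hC 0).1
  rw [memContDiffHolder_zero_iff hr0, memBoundedHolder_iff]
  refine ⟨⟨C, fun z => (hC z).1⟩, ⟨(2 * C + C).toNNReal, holderWith_of_dist_le fun z z' => ?_⟩⟩
  rw [dist_eq_norm, dist_eq_norm, Real.coe_toNNReal _ (by positivity)]
  exact holder_of_norm_fderiv_le hw r.coe_nonneg (by exact_mod_cast hr1) (fun z => (hC z).1)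
    (fun z => (hC z).2) z z'

/-! ### The theorem -/

/-- **Bootstrap and representation for the linear inhomogeneous `∂̄`-equation.** Let `0 < r < 1`
and assume the a priori Hölder estimate `CauchyTransformHolderApriori (ℂ × ℂ) r` for the Cauchy
transform `T = cauchyTransformAlong 1`. Let the operator field `S'` and `f` be smooth with compact
support, and let `w ∈ C¹(ℂ, ℂ²)` be bounded with bounded derivative, solve `∂̄ w = S' w + f`, and
tend to `c` at infinity. Then `w` is smooth and `w = c + T (S' w + f)` (Liouville applied to the
entire map `w - T (S' w + f)`, then bootstrapping through `C^{k,r}_b`; Vekua 1962, Ch. III).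
[folklore] -/
theorem contDiff_of_dbar_eq_linear {r : ℝ≥0} (hr0 : 0 < r) (hr1 : r < 1)
    (hT : CauchyTransformHolderApriori (ℂ × ℂ) r)
    (S' : ℂ → (ℂ × ℂ) →L[ℝ] (ℂ × ℂ)) (hS's : ContDiff ℝ ∞ S') (hS'c : HasCompactSupport S')
    (f : ℂ → ℂ × ℂ) (hfs : ContDiff ℝ ∞ f) (hfc : HasCompactSupport f)
    (w : ℂ → ℂ × ℂ) (hw : ContDiff ℝ 1 w) (hwb : ∃ C, ∀ z, ‖w z‖ ≤ C ∧ ‖fderiv ℝ w z‖ ≤ C)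
    (heq : ∀ z, dbarAlong (1 : ℂ) w z = S' z (w z) + f z)
    (c : ℂ × ℂ) (hlim : Tendsto w (cocompact ℂ) (𝓝 c)) :
    ContDiff ℝ ∞ w ∧ ∀ z, w z = c + cauchyTransformAlong (1 : ℂ) (fun y => S' y (w y) + f y) z := by
  -- the density `d = S' w + f`: `C¹`, compactly supported in a disc, bounded
  set d : ℂ → ℂ × ℂ := fun y => S' y (w y) + f y with hd
  have hd1 : ContDiff ℝ 1 d :=
    ((hS's.of_le (by exact_mod_cast le_top)).clm_apply hw).add
      (hfs.of_le (by exact_mod_cast le_top))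
  have hdc : HasCompactSupport d := by
    refine HasCompactSupport.add (hS'c.mono fun y hy => ?_) hfc
    rw [mem_support] at hy ⊢
    intro h0
    exact hy (by rw [h0, zero_apply])
  obtain ⟨R, hR⟩ := exists_forall_norm_lt_notMem_tsupport hdc
  obtain ⟨G, hG⟩ := hd1.continuous.bounded_above_of_compact_support hdc
  set ρ : ℝ := max R 0 + 1 with hρ_def
  have hρ : 0 < ρ := by positivity
  have hdρ : ∀ z, ρ ≤ ‖z‖ → d z = 0 := fun z hz =>
    image_eq_zero_of_notMem_tsupport
      (hR z (lt_of_lt_of_le (lt_of_le_of_lt (le_max_left R 0) (lt_add_one _)) hz))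
  -- the Cauchy transform `T d`: `C¹`, `∂̄ (T d) = d`, `T d → 0` at infinity
  have hTd1 : ContDiff ℝ 1 (cauchyTransformAlong (1 : ℂ) d) :=
    contDiff_cauchyTransformAlong hd1 hdc one_ne_zero
  have hTdbar : ∀ z, dbarAlong (1 : ℂ) (cauchyTransformAlong (1 : ℂ) d) z = d z := fun z =>
    dbarAlong_cauchyTransformAlong hd1 hdc one_ne_zero z
  have hTd0 : Tendsto (cauchyTransformAlong (1 : ℂ) d) (cocompact ℂ) (𝓝 0) :=
    tendsto_cauchyTransform_cocompact hρ hdρ hG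
  -- `w - T d` is an entire map tending to `c` at infinity, hence constant (Liouville)
  have hwd : Differentiable ℝ w := hw.differentiable one_ne_zero
  have hTdd : Differentiable ℝ (cauchyTransformAlong (1 : ℂ) d) :=
    hTd1.differentiable one_ne_zero
  have hdbar0 : ∀ z, dbarAlong (1 : ℂ) (fun y => w y - cauchyTransformAlong (1 : ℂ) d y) z = 0 := by
    intro z
    rw [dbarAlong_sub (hwd z) (hTdd z), heq z, hTdbar z]
    exact sub_self _
  have hhol : Differentiable ℂ fun y => w y - cauchyTransformAlong (1 : ℂ) d y := fun z =>
    (differentiableAt_complex_iff_dbarAlong_eq_zero ((hwd z).fun_sub (hTdd z))).2 fun v => by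
      have h1 := dbarAlong_smul_left v 1 (fun y => w y - cauchyTransformAlong (1 : ℂ) d y) z
      rw [smul_eq_mul, mul_one] at h1
      rw [h1, hdbar0 z, smul_zero]
  have hlim' : Tendsto (fun y => w y - cauchyTransformAlong (1 : ℂ) d y) (cocompact ℂ) (𝓝 c) := by
    simpa using hlim.sub hTd0
  have hrep : ∀ z, w z = c + cauchyTransformAlong (1 : ℂ) d z := fun z => by
    rw [← hhol.apply_eq_of_tendsto_cocompact z hlim', sub_add_cancel]
  -- bootstrap: `w ∈ C^{m,r}_b` for every `m`
  have hT' := cauchyTransform_contDiffHolder_succ (ℂ × ℂ) hr0 hr1 hT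
  have hr1' : r ≤ 1 := hr1.le
  have hwfun : w = fun z => c + cauchyTransformAlong (1 : ℂ) d z := funext hrep
  have hboot : ∀ m : ℕ, MemContDiffHolder m r w := by
    intro m
    induction m with
    | zero =>
      obtain ⟨C, hC⟩ := hwb
      exact memContDiffHolder_zero_of_norm_fderiv_le hr0 hr1' hwd hC
    | succ m ih =>
      have hdm : MemContDiffHolder m r d :=
        (memContDiffHolder_clm_apply_of_contDiff hr1' hS's hS'c ih).add
          (MemContDiffHolder.of_contDiff_of_hasCompactSupport hfs hfc hr1')
      obtain ⟨C, -, hC⟩ := hT' m ρ hρ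
      obtain ⟨hmem, -, -, -⟩ := hC ⟨d, hdm⟩ hdρ
      rw [hwfun]
      exact (memContDiffHolder_const c).add hmem
  refine ⟨?_, hrep⟩
  rw [contDiff_infty]
  intro m
  exact (hboot m).contDiff

end Literature.Analysis.Complex

end
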